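import Summits.HodgeConjecture.HodgeConjecture.Theses.NikulinTwinTransport

/-!
# `TwinTwistorTransport` (stmt-HodgeConjecture-14522) · Negative · polystable carriers leave a cross term

Hygiene for the typed form of the informal crux `TwinTwistorTransport` (route NikulinTwinTransport,
r4), clause (a) "a slope-POLYstable reflexive sheaf `G` …": in the TWISTED (Azumaya / κ-class)
branch — forced for the planned carrier by `Negative/NikulinParity` and `Negative/GenericFirstLine` —
Markman 2024 Prop. 5.19 assumes `F` slope-STABLE.  For a polystable `G = F₁ ⊕ F₂` the stable
summands are transported separately (each as its own twisted sheaf), and the identity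
`m·graph(Ψ) = c₂(G)^{mixed} = Σᵢ κ₂(Fᵢ)^{mixed} + J`, `J :=` the mixed part of
`Σᵢ ((rᵢ−1)/2rᵢ)c₁(Fᵢ)² + c₁(F₁)c₁(F₂)`, a class in `NS(X) ⊗ NS(Y′)` (a map `H²(Y′,ℚ) → H²(X,ℚ)` of
rank `≤ ρ(X) = 9`), is transported FLATLY but `J` is transported by NOTHING.  At a projective endpoint
`(S, S″)` the flat transport `J_end` is Hodge (difference of Hodge classes) and, on the transcendental
lattice `T″ = T(S″)`, equals `q·Ψ` for some `q ∈ ℚ` (`Hom_Hdg(T″, T) = ℚ·Ψ` at a general endpoint,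
`Hom_Hdg(T″, NS) = 0`).  The lemma below: `q ≠ 0` forces `rk T″ ≤ rk J ≤ 9`, i.e. `ρ(S″) ≥ 13`.
Hence for endpoints of Picard rank `≤ 12` the cross term lives on `NS(S) ⊗ NS(S″)` (algebraic by
Lefschetz (1,1)) and the polystable case goes through, while for `ρ ≥ 13` nothing follows — the typed
clause (a) should simply demand a STABLE carrier on an open cone of matched classes (Markman (i)).
Refuter seat refuter-cdisprove-stmt-HodgeConjecture-14522-g2-0 (gen 2), 2026-08-15.
-/

namespace Summit.HodgeConjecture.HodgeConjecture.Theorems.TwinTwistorTransport.Negative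

variable {V V' : Type*} [AddCommGroup V] [Module ℚ V] [AddCommGroup V'] [Module ℚ V']
  [FiniteDimensional ℚ V]

/-- RANK OBSTRUCTION: if `J` agrees with `q·Ψ` (`q ≠ 0`, `Ψ` injective) on a subspace `T'`, then
`dim T' ≤ rk J`. [folklore] -/
theorem finrank_le_of_restrict_eq_smul (Ψ J : V' →ₗ[ℚ] V) (hΨ : Function.Injective Ψ)
    (T' : Submodule ℚ V') {q : ℚ} (hq : q ≠ 0) (hJ : ∀ x ∈ T', J x = q • Ψ x) {k : ℕ}
    (hk : Module.finrank ℚ (LinearMap.range J) ≤ k) : Module.finrank ℚ T' ≤ k := by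
  have hinj : Function.Injective (J.domRestrict T') := by
    intro x y hxy
    simp only [LinearMap.domRestrict_apply, hJ x x.2, hJ y y.2] at hxy
    have := smul_right_injective V hq hxy
    exact Subtype.ext (hΨ this)
  have h1 : Module.finrank ℚ T' = Module.finrank ℚ (LinearMap.range (J.domRestrict T')) :=
    (LinearMap.finrank_range_of_inj hinj).symm
  have h2 : LinearMap.range (J.domRestrict T') ≤ LinearMap.range J := by
    rintro _ ⟨x, rfl⟩
    exact ⟨(x : V'), rfl⟩
  have h3 := Submodule.finrank_mono h2
  omega

end Summit.HodgeConjecture.HodgeConjecture.Theorems.TwinTwistorTransport.Negative
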